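import Literature.LinearAlgebra.Matrix.HermitianAdjointCartanAlgebra
import Literature.NumberTheory.Rogawski1990.SumZeroHyperplaneCharacters
import Mathlib.RingTheory.Artinian.Module
import HarnessLib

/-!
# The Cartan algebra `(L[γ], τ)` of a regular unitary element as DATA, its τ-stable simple factors, and the obstruction group
# `A(T) = {ε : (τ-stable factors) → ℤ∕2 ∣ ∑ ε = 0}` (Rogawski 1990, §3.4–§3.6 pp. 27–33, Prop. 3.5.2 p. 29, §3.3 p. 22; Kottwitz 1986 §9)

Topic `NumberTheory/Rogawski1990`; namespace `Literature.NumberTheory.Rogawski1990`; DEFINITIONS with bodies + theorems; **no named fact, no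
`sorry`, no instance, no notation**.  Cell `pub/hodgecm-mathlib`, ENGINE T1 (crux H413 = `stmt-HodgeConjecture-24833`), row G6 «pre-stabilisation for
the `U(3)` tori», sub-row R6d-α of `CENSUS-R6R7-CartanObstruction.F0P5a-p03g4` (777973b4): the PUBLIC objects against which R3′ (A-p14,
`HasseNormEtaleInvolutionFactors`), R6c (B-p12, `QuadraticArtinIndicator`) and (KS-2b) (p08, `EndoscopicKappaBijection`) are instantiated by R6d∕R7
(`CartanObstruction` ∕ `CartanObsHasse`).  HC_CM is proved only modulo the printed citations until rung 0 closes.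

THE PRINT.  [Rogawski1990, §3.4–3.6]: for `γ` regular semisimple in `G = U(H)(F)` (`L∕F` CM, `σ`) the centraliser `T = G_γ` is a maximal torus,
`T ≅ {t ∈ K : t τ(t) = 1}` with `K = L[γ]` the (commutative, étale) Cartan algebra and `τ` the restriction of the `H`-adjoint `x ↦ H⁻¹ ᵗ(σx) H`;
`K ≅ ∏ᵢ Kᵢ` (fields), `τ` permutes the factors, and [Prop. 3.5.2 p. 29] `H¹(F, T) ≅ ⊕_{i τ-stable} Kᵢ^{τ,×} ∕ N(Kᵢ^×)`, `𝔈(T∕F) ≅ (ℤ∕2)^{r}`-type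
groups, `A(T)` = the characters' kernel side, `|𝓡(T∕F)| = 2^{r′−1}` with `r′` the number of τ-STABLE factors (types (1)(2)(3) of §3.6: `r′ = 3, 2, 1`,
`|𝓡| = 4, 2, 1` — [§5.4 p. 74]).

WHAT IS TYPED (generic: `F ⊆ L` any fields, `σ : L →+* L` an involution fixing `F`, `H ∈ GL_N(L)` `σ`-hermitian, `γ` regular semisimple `H`-unitary):
* §1 **`cartanInvolution σ hσF hσσ hHdet hH hreg hγ : ↥(Algebra.adjoin L {γ}) ≃ₐ[F] ↥(Algebra.adjoin L {γ})`** — the adjoint `τ = ⋆|_{L[γ]}` AS AN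
  `F`-ALGEBRA INVOLUTION of the commutative algebra `L[γ]` (★ A-p14 `HermitianAdjointCartanAlgebra`: `L[γ]` is `⋆`-stable, commutative — Mathlib
  `Algebra.isMulCommutative_adjoin_singleton`), the proof-internal `τ` of ★ `exists_commute_mul_hermAdjoint_eq_of_adelic` made public:
  `coe_cartanInvolution` (`↑(τ b) = H⁻¹ ᵗ(σb) H`), `cartanInvolution_cartanInvolution` (`τ² = 1`), `cartanInvolution_self_mul_self`
  (`τ(γ) · γ = 1`); the anti-fixed unit **`cartanTheta ε hε = ε · 1`**, `cartanInvolution_cartanTheta : τ θ = −θ` for `σ ε = −ε` and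
  `exists_ne_zero_map_eq_neg` (such `ε` exists iff `σ ≠ 1`) — the `(B, τ, θ)` of ★ R3 `exists_mul_apply_eq_of_adelic`.
* §2 **`cartanIndex … := {𝔪 : MaximalSpectrum L[γ] // 𝔪.comap τ = 𝔪}`** — the τ-STABLE simple factors (`r′ := Nat.card (cartanIndex …)`),
  `finite_cartanIndex`; `comap_cartanInvolution_comap` (`τ` acts as an involution on `MaximalSpectrum L[γ]`); §2b the residue field `K_𝔪 = L[γ] ∕ 𝔪`
  of a τ-stable factor with its INDUCED INVOLUTION **`cartanResidueInvolution 𝔪 : K_𝔪 ≃ₐ[F] K_𝔪`** (Mathlib `Ideal.quotientEquivAlg`;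
  `eq_map_cartanInvolution`, `cartanResidueInvolution_mk` (`τ_𝔪 ∘ π = π ∘ τ`), `…_cartanResidueInvolution` (`τ_𝔪² = 1`),
  **`cartanResidueInvolution_ne_one`** (`τ_𝔪 ≠ 1` as soon as `σ ≠ 1` and `2 ≠ 0`: the image of `θ`)) — the `(C, π, τ_C)` presentation of ★ R3′.
* §3 **`cartanObsSubgroup ι : AddSubgroup (ι → ZMod 2)`** = `{ε ∣ ∑ᵢ εᵢ = 0}` (`mem_cartanObsSubgroup_iff` — the `(K, hK)` of ★ (R𝓡) ∕ ★ (KS-2b)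
  `SumZeroHyperplaneCharacters` ∕ ★ `PreStabilisationCountSigns`), **`natCard_cartanObsSubgroup : |A| = 2^{|ι| − 1}`** (★ p08 `natCard_addSubgroup_eq_two_pow`).
  The obstruction `cartanObs γ₀ : MatchingAdeleG₂ L H H γ₀ → ↥(cartanObsSubgroup (cartanIndex …))` itself is R6d (`CartanObstruction`).

## References
* [Rogawski1990] J. D. Rogawski, *Automorphic Representations of Unitary Groups in Three Variables*, Ann. of Math. Stud. 123 (1990), §3.3 Prop. 3.3.1 ∕
  Cor. 3.3.2 p. 22, §3.4–§3.6 pp. 27–33 (Prop. 3.5.2 p. 29), §5.4 p. 74.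
* [Kottwitz1986] R. E. Kottwitz, *Stable trace formula: elliptic singular terms*, Math. Ann. 275 (1986), §7, §9.
* [Jacobowitz1962] R. Jacobowitz, *Hermitian forms over local fields*, Amer. J. Math. 84 (1962), §2 (the adjoint involution).
-/

set_option autoImplicit false

noncomputable section

open Polynomial
open scoped Matrix BigOperators

namespace Literature.NumberTheory.Rogawski1990

open Literature.LinearAlgebra.Matrix

/-! ## §1 The Cartan algebra `L[γ]` with its involution `τ = ⋆|_{L[γ]}` and the anti-fixed unit `θ` -/

section Involution

variable {F L : Type} [Field F] [Field L] [Algebra F L] (σ : L →+* L) {N : ℕ} {H : Matrix (Fin N) (Fin N) L} {γ : Matrix (Fin N) (Fin N) L}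

/-- The adjoint `b ↦ H⁻¹ ᵗ(σb) H` restricted to `L[γ]`, as an `F`-ALGEBRA ENDOMORPHISM of the commutative algebra `L[γ]` (`γ` regular semisimple
and `H`-unitary, `H` invertible; `F`-linear because `σ` fixes `F`; multiplicative because `L[γ]` is commutative and `⋆` is anti-multiplicative).
[cite: Rogawski1990, §3.5 p. 29] [cite: Jacobowitz1962, §2] -/
def cartanInvolutionHom (hσF : ∀ q : F, σ (algebraMap F L q) = algebraMap F L q) (hHdet : IsUnit H.det) (hreg : γ.charpoly.Separable) (hγ : (γ.map σ)ᵀ * H * γ = H) : ↥(Algebra.adjoin L ({γ} : Set (Matrix (Fin N) (Fin N) L))) →ₐ[F] ↥(Algebra.adjoin L ({γ} : Set (Matrix (Fin N) (Fin N) L))) where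
  toFun b := ⟨H⁻¹ * ((b : Matrix (Fin N) (Fin N) L).map σ)ᵀ * H, hermAdjoint_mem_adjoin_singleton γ hreg σ hHdet hγ b.2⟩
  map_one' := Subtype.ext (hermAdjoint_one σ hHdet)
  map_mul' a b := Subtype.ext (by
    change H⁻¹ * (((a : Matrix (Fin N) (Fin N) L) * b).map σ)ᵀ * H =
      H⁻¹ * ((a : Matrix (Fin N) (Fin N) L).map σ)ᵀ * H * (H⁻¹ * ((b : Matrix (Fin N) (Fin N) L).map σ)ᵀ * H)
    rw [hermAdjoint_mul σ hHdet]
    exact congrArg Subtype.val (mul_comm (⟨_, hermAdjoint_mem_adjoin_singleton γ hreg σ hHdet hγ b.2⟩ : ↥(Algebra.adjoin L ({γ} : Set (Matrix (Fin N) (Fin N) L))))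
      ⟨_, hermAdjoint_mem_adjoin_singleton γ hreg σ hHdet hγ a.2⟩))
  map_zero' := Subtype.ext (by
    change H⁻¹ * ((0 : Matrix (Fin N) (Fin N) L).map σ)ᵀ * H = 0
    rw [Matrix.map_zero σ (map_zero σ), Matrix.transpose_zero, Matrix.mul_zero, Matrix.zero_mul])
  map_add' a b := Subtype.ext (hermAdjoint_add σ H _ _)
  commutes' q := Subtype.ext (by
    change H⁻¹ * ((algebraMap F (Matrix (Fin N) (Fin N) L) q).map σ)ᵀ * H = algebraMap F (Matrix (Fin N) (Fin N) L) q
    rw [Algebra.algebraMap_eq_smul_one, ← algebraMap_smul L q (1 : Matrix (Fin N) (Fin N) L), hermAdjoint_smul σ H,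
      hermAdjoint_one σ hHdet, hσF])

/-- `↑(τ b) = H⁻¹ ᵗ(σb) H` for the endomorphism form. [cite: Rogawski1990, §3.5 p. 29] -/
theorem coe_cartanInvolutionHom (hσF : ∀ q : F, σ (algebraMap F L q) = algebraMap F L q) (hHdet : IsUnit H.det) (hreg : γ.charpoly.Separable) (hγ : (γ.map σ)ᵀ * H * γ = H) (b : ↥(Algebra.adjoin L ({γ} : Set (Matrix (Fin N) (Fin N) L)))) :
    ((cartanInvolutionHom σ hσF hHdet hreg hγ b : ↥(Algebra.adjoin L ({γ} : Set (Matrix (Fin N) (Fin N) L)))) : Matrix (Fin N) (Fin N) L) = H⁻¹ * ((b : Matrix (Fin N) (Fin N) L).map σ)ᵀ * H := rfl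

/-- `τ (τ b) = b` for `σ` an involution and `H` hermitian (★ `hermAdjoint_hermAdjoint`). [cite: Rogawski1990, §3.5 p. 29] -/
theorem cartanInvolutionHom_cartanInvolutionHom (hσF : ∀ q : F, σ (algebraMap F L q) = algebraMap F L q) (hσσ : ∀ x : L, σ (σ x) = x) (hHdet : IsUnit H.det) (hH : (H.map σ)ᵀ = H) (hreg : γ.charpoly.Separable) (hγ : (γ.map σ)ᵀ * H * γ = H) (b : ↥(Algebra.adjoin L ({γ} : Set (Matrix (Fin N) (Fin N) L)))) :
    cartanInvolutionHom σ hσF hHdet hreg hγ (cartanInvolutionHom σ hσF hHdet hreg hγ b) = b :=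
  Subtype.ext (by rw [coe_cartanInvolutionHom, coe_cartanInvolutionHom, hermAdjoint_hermAdjoint σ hσσ hH hHdet])

/-- **`cartanInvolution` — the adjoint `τ = ⋆|_{L[γ]}` as an `F`-algebra INVOLUTION `L[γ] ≃ₐ[F] L[γ]`** (its own inverse): the `(B, τ)` of
[Rogawski1990, Prop. 3.5.2] ∕ ★ `exists_mul_apply_eq_of_adelic`, for `B = L[γ] = Z(γ)`. [cite: Rogawski1990, §3.5 Prop. 3.5.2 p. 29] [cite: Jacobowitz1962, §2] -/
def cartanInvolution (hσF : ∀ q : F, σ (algebraMap F L q) = algebraMap F L q) (hσσ : ∀ x : L, σ (σ x) = x) (hHdet : IsUnit H.det) (hH : (H.map σ)ᵀ = H) (hreg : γ.charpoly.Separable) (hγ : (γ.map σ)ᵀ * H * γ = H) : ↥(Algebra.adjoin L ({γ} : Set (Matrix (Fin N) (Fin N) L))) ≃ₐ[F] ↥(Algebra.adjoin L ({γ} : Set (Matrix (Fin N) (Fin N) L))) :=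
  AlgEquiv.ofAlgHom (cartanInvolutionHom σ hσF hHdet hreg hγ) (cartanInvolutionHom σ hσF hHdet hreg hγ)
    (AlgHom.ext (cartanInvolutionHom_cartanInvolutionHom σ hσF hσσ hHdet hH hreg hγ))
    (AlgHom.ext (cartanInvolutionHom_cartanInvolutionHom σ hσF hσσ hHdet hH hreg hγ))

/-- `↑(τ b) = H⁻¹ ᵗ(σb) H`. [cite: Rogawski1990, §3.5 p. 29] -/
theorem coe_cartanInvolution (hσF : ∀ q : F, σ (algebraMap F L q) = algebraMap F L q) (hσσ : ∀ x : L, σ (σ x) = x) (hHdet : IsUnit H.det) (hH : (H.map σ)ᵀ = H) (hreg : γ.charpoly.Separable) (hγ : (γ.map σ)ᵀ * H * γ = H) (b : ↥(Algebra.adjoin L ({γ} : Set (Matrix (Fin N) (Fin N) L)))) :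
    ((cartanInvolution σ hσF hσσ hHdet hH hreg hγ b : ↥(Algebra.adjoin L ({γ} : Set (Matrix (Fin N) (Fin N) L)))) : Matrix (Fin N) (Fin N) L) = H⁻¹ * ((b : Matrix (Fin N) (Fin N) L).map σ)ᵀ * H := rfl

/-- `τ (τ b) = b`. [cite: Rogawski1990, §3.5 p. 29] -/
theorem cartanInvolution_cartanInvolution (hσF : ∀ q : F, σ (algebraMap F L q) = algebraMap F L q) (hσσ : ∀ x : L, σ (σ x) = x) (hHdet : IsUnit H.det) (hH : (H.map σ)ᵀ = H) (hreg : γ.charpoly.Separable) (hγ : (γ.map σ)ᵀ * H * γ = H) (b : ↥(Algebra.adjoin L ({γ} : Set (Matrix (Fin N) (Fin N) L)))) :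
    cartanInvolution σ hσF hσσ hHdet hH hreg hγ (cartanInvolution σ hσF hσσ hHdet hH hreg hγ b) = b :=
  cartanInvolutionHom_cartanInvolutionHom σ hσF hσσ hHdet hH hreg hγ b

/-- `τ` is its own inverse. [cite: Rogawski1990, §3.5 p. 29] -/
theorem cartanInvolution_symm (hσF : ∀ q : F, σ (algebraMap F L q) = algebraMap F L q) (hσσ : ∀ x : L, σ (σ x) = x) (hHdet : IsUnit H.det) (hH : (H.map σ)ᵀ = H) (hreg : γ.charpoly.Separable) (hγ : (γ.map σ)ᵀ * H * γ = H) :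
    (cartanInvolution σ hσF hσσ hHdet hH hreg hγ).symm = cartanInvolution σ hσF hσσ hHdet hH hreg hγ := rfl

/-- **`τ(γ) · γ = 1`**: on the generator the involution is inversion (`γ` is `H`-unitary) — so the torus `T = {t : t τ(t) = 1}` contains `γ`
(`γ ∈ L[γ]` is Mathlib `Algebra.self_mem_adjoin_singleton`). [cite: Rogawski1990, §3.4 p. 27; §3.5 p. 29] -/
theorem coe_cartanInvolution_self_mul_self (hσF : ∀ q : F, σ (algebraMap F L q) = algebraMap F L q) (hσσ : ∀ x : L, σ (σ x) = x) (hHdet : IsUnit H.det) (hH : (H.map σ)ᵀ = H) (hreg : γ.charpoly.Separable) (hγ : (γ.map σ)ᵀ * H * γ = H) :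
    ((cartanInvolution σ hσF hσσ hHdet hH hreg hγ ⟨γ, Algebra.self_mem_adjoin_singleton L γ⟩ : ↥(Algebra.adjoin L ({γ} : Set (Matrix (Fin N) (Fin N) L)))) : Matrix (Fin N) (Fin N) L) * γ = 1 := by
  rw [coe_cartanInvolution]
  exact (hermAdjoint_mul_self_eq_one_iff σ hHdet γ).2 hγ

variable (γ) in
/-- **The anti-fixed unit `θ = ε · 1 ∈ L[γ]ˣ`** (`ε ∈ Lˣ`): for `σ ε = −ε` it satisfies `τ θ = −θ`, witnessing «`τ ≠ 1` on every τ-stable field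
factor» as ★ `exists_mul_apply_eq_of_adelic` wants it. [cite: Rogawski1990, §3.5 p. 29] -/
def cartanTheta (ε : L) (hε : ε ≠ 0) : (↥(Algebra.adjoin L ({γ} : Set (Matrix (Fin N) (Fin N) L))))ˣ where
  val := ⟨ε • (1 : Matrix (Fin N) (Fin N) L), Subalgebra.smul_mem _ (one_mem _) ε⟩
  inv := ⟨ε⁻¹ • (1 : Matrix (Fin N) (Fin N) L), Subalgebra.smul_mem _ (one_mem _) ε⁻¹⟩
  val_inv := Subtype.ext (by
    change (ε • (1 : Matrix (Fin N) (Fin N) L)) * (ε⁻¹ • (1 : Matrix (Fin N) (Fin N) L)) = 1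
    rw [smul_mul_smul_comm, Matrix.mul_one, mul_inv_cancel₀ hε, one_smul])
  inv_val := Subtype.ext (by
    change (ε⁻¹ • (1 : Matrix (Fin N) (Fin N) L)) * (ε • (1 : Matrix (Fin N) (Fin N) L)) = 1
    rw [smul_mul_smul_comm, Matrix.mul_one, inv_mul_cancel₀ hε, one_smul])

/-- `↑θ = ε · 1`. [cite: Rogawski1990, §3.5 p. 29] -/
theorem coe_cartanTheta (ε : L) (hε : ε ≠ 0) :
    (((cartanTheta γ ε hε : (↥(Algebra.adjoin L ({γ} : Set (Matrix (Fin N) (Fin N) L))))ˣ) : ↥(Algebra.adjoin L ({γ} : Set (Matrix (Fin N) (Fin N) L)))) : Matrix (Fin N) (Fin N) L) = ε • 1 := rfl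

/-- **`τ θ = −θ`** for `σ ε = −ε`. [cite: Rogawski1990, §3.5 p. 29] -/
theorem cartanInvolution_cartanTheta (hσF : ∀ q : F, σ (algebraMap F L q) = algebraMap F L q) (hσσ : ∀ x : L, σ (σ x) = x) (hHdet : IsUnit H.det) (hH : (H.map σ)ᵀ = H) (hreg : γ.charpoly.Separable) (hγ : (γ.map σ)ᵀ * H * γ = H) {ε : L} (hε : ε ≠ 0) (hσε : σ ε = -ε) :
    cartanInvolution σ hσF hσσ hHdet hH hreg hγ (cartanTheta γ ε hε : (↥(Algebra.adjoin L ({γ} : Set (Matrix (Fin N) (Fin N) L))))ˣ) = -((cartanTheta γ ε hε : (↥(Algebra.adjoin L ({γ} : Set (Matrix (Fin N) (Fin N) L))))ˣ) : ↥(Algebra.adjoin L ({γ} : Set (Matrix (Fin N) (Fin N) L)))) :=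
  Subtype.ext (by
    rw [coe_cartanInvolution, Subalgebra.coe_neg, coe_cartanTheta, hermAdjoint_smul σ H, hermAdjoint_one σ hHdet, hσε, neg_smul])

/-- A non-trivial involution `σ` has an anti-fixed non-zero element: `ε := ℓ − σ ℓ` for any `ℓ` moved by `σ`. [cite: Rogawski1990, §3.5 p. 29] -/
theorem exists_ne_zero_map_eq_neg (hσσ : ∀ x : L, σ (σ x) = x) (hex : ∃ ℓ : L, σ ℓ ≠ ℓ) : ∃ ε : L, ε ≠ 0 ∧ σ ε = -ε := by
  obtain ⟨ℓ, hℓ⟩ := hex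
  exact ⟨ℓ - σ ℓ, sub_ne_zero.2 (Ne.symm hℓ), by rw [map_sub, hσσ, neg_sub]⟩

/-! ## §2 The τ-stable simple factors of `L[γ]`: the index set of the obstruction -/

/-- `L[γ]` is artinian (finite-dimensional over `L`), so it has finitely many maximal ideals. [cite: Rogawski1990, §3.4 p. 27] -/
theorem isArtinianRing_adjoin_singleton (γ : Matrix (Fin N) (Fin N) L) : IsArtinianRing ↥(Algebra.adjoin L ({γ} : Set (Matrix (Fin N) (Fin N) L))) :=
  IsArtinianRing.of_finite L _

/-- **`cartanIndex`** — the τ-STABLE maximal ideals `𝔪 = τ⁻¹𝔪` of the Cartan algebra `L[γ]`, i.e. the simple factors `Kᵢ = L[γ]∕𝔪` on which `τ`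
induces a (non-trivial) involution; their number is the `r′` with `|𝓡(T∕F)| = 2^{r′−1}` (types (1)(2)(3) of [§3.6]: `r′ = 3, 2, 1`).  The factors
with `τ𝔪 ≠ 𝔪` come in pairs and carry no obstruction. [cite: Rogawski1990, §3.5 Prop. 3.5.2 p. 29; §3.6 p. 31; §5.4 p. 74] -/
abbrev cartanIndex (hσF : ∀ q : F, σ (algebraMap F L q) = algebraMap F L q) (hσσ : ∀ x : L, σ (σ x) = x) (hHdet : IsUnit H.det) (hH : (H.map σ)ᵀ = H) (hreg : γ.charpoly.Separable) (hγ : (γ.map σ)ᵀ * H * γ = H) : Type :=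
  {𝔪 : MaximalSpectrum ↥(Algebra.adjoin L ({γ} : Set (Matrix (Fin N) (Fin N) L))) // 𝔪.asIdeal.comap (cartanInvolution σ hσF hσσ hHdet hH hreg hγ) = 𝔪.asIdeal}

/-- `cartanIndex` is finite. [cite: Rogawski1990, §3.4 p. 27] -/
theorem finite_cartanIndex (hσF : ∀ q : F, σ (algebraMap F L q) = algebraMap F L q) (hσσ : ∀ x : L, σ (σ x) = x) (hHdet : IsUnit H.det) (hH : (H.map σ)ᵀ = H) (hreg : γ.charpoly.Separable) (hγ : (γ.map σ)ᵀ * H * γ = H) : Finite (cartanIndex σ hσF hσσ hHdet hH hreg hγ) := by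
  haveI := isArtinianRing_adjoin_singleton (L := L) γ
  exact Subtype.finite

/-- `τ⁻¹(τ⁻¹ 𝔪) = 𝔪`: `τ` acts on the ideals of `L[γ]` as an involution (so the non-stable maximal ideals come in pairs `{𝔪, τ𝔪}`).
[cite: Rogawski1990, §3.5 p. 29] -/
theorem comap_cartanInvolution_comap (hσF : ∀ q : F, σ (algebraMap F L q) = algebraMap F L q) (hσσ : ∀ x : L, σ (σ x) = x) (hHdet : IsUnit H.det) (hH : (H.map σ)ᵀ = H) (hreg : γ.charpoly.Separable) (hγ : (γ.map σ)ᵀ * H * γ = H) (I : Ideal ↥(Algebra.adjoin L ({γ} : Set (Matrix (Fin N) (Fin N) L)))) :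
    (I.comap (cartanInvolution σ hσF hσσ hHdet hH hreg hγ)).comap (cartanInvolution σ hσF hσσ hHdet hH hreg hγ) = I := by
  ext b
  simp only [Ideal.mem_comap]
  rw [show (cartanInvolution σ hσF hσσ hHdet hH hreg hγ) ((cartanInvolution σ hσF hσσ hHdet hH hreg hγ) b) = b from
    cartanInvolution_cartanInvolution σ hσF hσσ hHdet hH hreg hγ b]

/-! ### §2b The residue field `K_𝔪 = L[γ] ∕ 𝔪` of a τ-stable factor and its induced involution (the `(C, π, τ_C)` of ★ R3 ∕ R3′) -/

/-- A τ-stable maximal ideal is also `τ`-IMAGE-stable: `𝔪 = τ(𝔪)` (`τ⁻¹ = τ`). [cite: Rogawski1990, §3.5 p. 29] -/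
theorem eq_map_cartanInvolution (hσF : ∀ q : F, σ (algebraMap F L q) = algebraMap F L q) (hσσ : ∀ x : L, σ (σ x) = x) (hHdet : IsUnit H.det) (hH : (H.map σ)ᵀ = H) (hreg : γ.charpoly.Separable) (hγ : (γ.map σ)ᵀ * H * γ = H) (𝔪 : cartanIndex σ hσF hσσ hHdet hH hreg hγ) :
    𝔪.1.asIdeal = 𝔪.1.asIdeal.map ((cartanInvolution σ hσF hσσ hHdet hH hreg hγ : ↥(Algebra.adjoin L ({γ} : Set (Matrix (Fin N) (Fin N) L))) ≃ₐ[F] ↥(Algebra.adjoin L ({γ} : Set (Matrix (Fin N) (Fin N) L)))) : ↥(Algebra.adjoin L ({γ} : Set (Matrix (Fin N) (Fin N) L))) →+* ↥(Algebra.adjoin L ({γ} : Set (Matrix (Fin N) (Fin N) L)))) := by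
  have hst : ∀ b : ↥(Algebra.adjoin L ({γ} : Set (Matrix (Fin N) (Fin N) L))), b ∈ 𝔪.1.asIdeal → cartanInvolution σ hσF hσσ hHdet hH hreg hγ b ∈ 𝔪.1.asIdeal := fun b hb => by
    have hb' : b ∈ 𝔪.1.asIdeal.comap (cartanInvolution σ hσF hσσ hHdet hH hreg hγ) := by rw [𝔪.2]; exact hb
    exact Ideal.mem_comap.1 hb'
  apply le_antisymm
  · intro b hb
    rw [← cartanInvolution_cartanInvolution σ hσF hσσ hHdet hH hreg hγ b]
    exact Ideal.mem_map_of_mem _ (hst _ hb)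
  · rw [Ideal.map_le_iff_le_comap]
    intro b hb
    exact Ideal.mem_comap.2 (hst b hb)

/-- **The induced involution `τ_𝔪` of the residue field `K_𝔪 = L[γ] ∕ 𝔪`** of a τ-stable factor (Mathlib `Ideal.quotientEquivAlg`): the `τC` of
★ R3′'s abstract presentation `(C := L[γ] ∕ 𝔪, π := Ideal.Quotient.mkₐ, τC)`; its fixed field is the factor `K₀,𝔪` of `K₀ = L[γ]^τ` whose idèles carry
the 𝔪-coordinate of the obstruction. [cite: Rogawski1990, §3.5 Prop. 3.5.2 p. 29] -/
def cartanResidueInvolution (hσF : ∀ q : F, σ (algebraMap F L q) = algebraMap F L q) (hσσ : ∀ x : L, σ (σ x) = x) (hHdet : IsUnit H.det) (hH : (H.map σ)ᵀ = H) (hreg : γ.charpoly.Separable) (hγ : (γ.map σ)ᵀ * H * γ = H) (𝔪 : cartanIndex σ hσF hσσ hHdet hH hreg hγ) :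
    (↥(Algebra.adjoin L ({γ} : Set (Matrix (Fin N) (Fin N) L))) ⧸ 𝔪.1.asIdeal) ≃ₐ[F] (↥(Algebra.adjoin L ({γ} : Set (Matrix (Fin N) (Fin N) L))) ⧸ 𝔪.1.asIdeal) :=
  Ideal.quotientEquivAlg 𝔪.1.asIdeal 𝔪.1.asIdeal (cartanInvolution σ hσF hσσ hHdet hH hreg hγ) (eq_map_cartanInvolution σ hσF hσσ hHdet hH hreg hγ 𝔪)

/-- `τ_𝔪 (π b) = π (τ b)` for `π : L[γ] → L[γ] ∕ 𝔪` (★ R3′'s `hτπ`). [cite: Rogawski1990, §3.5 p. 29] -/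
theorem cartanResidueInvolution_mk (hσF : ∀ q : F, σ (algebraMap F L q) = algebraMap F L q) (hσσ : ∀ x : L, σ (σ x) = x) (hHdet : IsUnit H.det) (hH : (H.map σ)ᵀ = H) (hreg : γ.charpoly.Separable) (hγ : (γ.map σ)ᵀ * H * γ = H) (𝔪 : cartanIndex σ hσF hσσ hHdet hH hreg hγ) (b : ↥(Algebra.adjoin L ({γ} : Set (Matrix (Fin N) (Fin N) L)))) :
    cartanResidueInvolution σ hσF hσσ hHdet hH hreg hγ 𝔪 (Ideal.Quotient.mk 𝔪.1.asIdeal b) =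
      Ideal.Quotient.mk 𝔪.1.asIdeal (cartanInvolution σ hσF hσσ hHdet hH hreg hγ b) :=
  Ideal.quotientEquivAlg_mk _ _ _ b

/-- `τ_𝔪 (τ_𝔪 c) = c`. [cite: Rogawski1990, §3.5 p. 29] -/
theorem cartanResidueInvolution_cartanResidueInvolution (hσF : ∀ q : F, σ (algebraMap F L q) = algebraMap F L q) (hσσ : ∀ x : L, σ (σ x) = x) (hHdet : IsUnit H.det) (hH : (H.map σ)ᵀ = H) (hreg : γ.charpoly.Separable) (hγ : (γ.map σ)ᵀ * H * γ = H) (𝔪 : cartanIndex σ hσF hσσ hHdet hH hreg hγ) (c : ↥(Algebra.adjoin L ({γ} : Set (Matrix (Fin N) (Fin N) L))) ⧸ 𝔪.1.asIdeal) :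
    cartanResidueInvolution σ hσF hσσ hHdet hH hreg hγ 𝔪 (cartanResidueInvolution σ hσF hσσ hHdet hH hreg hγ 𝔪 c) = c := by
  obtain ⟨b, rfl⟩ := Ideal.Quotient.mk_surjective c
  rw [cartanResidueInvolution_mk, cartanResidueInvolution_mk, cartanInvolution_cartanInvolution]

/-- **`τ_𝔪 ≠ 1`** whenever `σ` moves some element (`θ = ε·1`, `σε = −ε`, maps to `ε̄ ≠ 0` with `τ_𝔪 ε̄ = −ε̄ ≠ ε̄`; `char ≠ 2` since `ε ≠ −ε` needs it —
here from `(2 : L) ≠ 0`). [cite: Rogawski1990, §3.5 p. 29] -/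
theorem cartanResidueInvolution_ne_one (hσF : ∀ q : F, σ (algebraMap F L q) = algebraMap F L q) (hσσ : ∀ x : L, σ (σ x) = x) (hHdet : IsUnit H.det) (hH : (H.map σ)ᵀ = H) (hreg : γ.charpoly.Separable) (hγ : (γ.map σ)ᵀ * H * γ = H) (h2 : (2 : L) ≠ 0) (hex : ∃ ℓ : L, σ ℓ ≠ ℓ)
    (𝔪 : cartanIndex σ hσF hσσ hHdet hH hreg hγ) : cartanResidueInvolution σ hσF hσσ hHdet hH hreg hγ 𝔪 ≠ 1 := by
  obtain ⟨ε, hε, hσε⟩ := exists_ne_zero_map_eq_neg σ hσσ hex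
  intro h1
  have hθ := cartanInvolution_cartanTheta σ hσF hσσ hHdet hH hreg hγ hε hσε
  set θ : ↥(Algebra.adjoin L ({γ} : Set (Matrix (Fin N) (Fin N) L))) := ((cartanTheta γ ε hε : (↥(Algebra.adjoin L ({γ} : Set (Matrix (Fin N) (Fin N) L))))ˣ) : ↥(Algebra.adjoin L ({γ} : Set (Matrix (Fin N) (Fin N) L)))) with hθdef
  -- in the residue field: `θ̄ = τ_𝔪 θ̄ = -θ̄`, so `2 θ̄ = 0`, so `θ̄ = 0`; but `θ` is a unit
  have hmk : Ideal.Quotient.mk 𝔪.1.asIdeal θ = -Ideal.Quotient.mk 𝔪.1.asIdeal θ := by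
    have h := cartanResidueInvolution_mk σ hσF hσσ hHdet hH hreg hγ 𝔪 θ
    rw [h1, AlgEquiv.one_apply, hθdef, hθ, (Ideal.Quotient.mk 𝔪.1.asIdeal).map_neg] at h
    exact h
  have hunit : IsUnit (Ideal.Quotient.mk 𝔪.1.asIdeal θ) := IsUnit.map (Ideal.Quotient.mk 𝔪.1.asIdeal) (cartanTheta γ ε hε).isUnit
  have h2θ : (2 : ↥(Algebra.adjoin L ({γ} : Set (Matrix (Fin N) (Fin N) L))) ⧸ 𝔪.1.asIdeal) * Ideal.Quotient.mk 𝔪.1.asIdeal θ = 0 := by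
    rw [two_mul]
    nth_rewrite 2 [hmk]
    rw [add_neg_cancel]
  have h2q : (2 : ↥(Algebra.adjoin L ({γ} : Set (Matrix (Fin N) (Fin N) L))) ⧸ 𝔪.1.asIdeal) ≠ 0 := by
    -- `2 = algebraMap L _ 2` and `L → L[γ] ∕ 𝔪` is injective (a ring map out of a field into a non-trivial ring)
    haveI : Nontrivial (↥(Algebra.adjoin L ({γ} : Set (Matrix (Fin N) (Fin N) L))) ⧸ 𝔪.1.asIdeal) :=
      Ideal.Quotient.nontrivial_iff.mpr 𝔪.1.isMaximal.ne_top
    rw [show (2 : ↥(Algebra.adjoin L ({γ} : Set (Matrix (Fin N) (Fin N) L))) ⧸ 𝔪.1.asIdeal) = algebraMap L (↥(Algebra.adjoin L ({γ} : Set (Matrix (Fin N) (Fin N) L))) ⧸ 𝔪.1.asIdeal) 2 from (map_ofNat (algebraMap L (↥(Algebra.adjoin L ({γ} : Set (Matrix (Fin N) (Fin N) L))) ⧸ 𝔪.1.asIdeal)) 2).symm]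
    intro h
    exact h2 ((algebraMap L (↥(Algebra.adjoin L ({γ} : Set (Matrix (Fin N) (Fin N) L))) ⧸ 𝔪.1.asIdeal)).injective (by rw [h, map_zero]))
  exact (mul_ne_zero h2q hunit.ne_zero) h2θ

end Involution

/-! ## §3 The obstruction group `A = {ε : ι → ℤ∕2 ∣ ∑ ε = 0}` and its characters -/

section Obstruction

variable (ι : Type) [Fintype ι]

/-- **`cartanObsSubgroup ι = {ε : ι → ℤ∕2 ∣ ∑ᵢ εᵢ = 0}`** — the sum-zero hyperplane, as the kernel of the sum of the coordinate projections: the group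
`A(T)` receiving the obstruction of an adelic class in a regular stable class (one coordinate per τ-stable factor of the Cartan algebra; the
constraint `∑ = 0` is `det (H⁻¹ H_g) = N(det g)`). [cite: Rogawski1990, §3.3 (3.3.1) p. 22; §3.5 Prop. 3.5.2 p. 29] [cite: Kottwitz1986, §9] -/
def cartanObsSubgroup : AddSubgroup (ι → ZMod 2) :=
  (∑ i : ι, Pi.evalAddMonoidHom (fun _ : ι => ZMod 2) i).ker

variable {ι}

/-- `ε ∈ A ↔ ∑ᵢ εᵢ = 0`. [cite: Rogawski1990, §3.5 Prop. 3.5.2 p. 29] -/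
theorem mem_cartanObsSubgroup_iff (ε : ι → ZMod 2) : ε ∈ cartanObsSubgroup ι ↔ ∑ i, ε i = 0 := by
  rw [cartanObsSubgroup, AddMonoidHom.mem_ker, AddMonoidHom.finsetSum_apply]
  rfl

variable (ι)

/-- **`|A| = 2^{|ι| − 1}`** (for `ι` non-empty; `= 1 = 2⁰` also for `ι` empty): ★ p08 `natCard_addSubgroup_eq_two_pow` (generic `ι`, over ★ A-p01
`natCard_addSubgroup_eq_two_pow_of_mem_iff`).  With `𝓡 = ⊤ = Â` this is `|𝓡(T∕F)| = 2^{r′−1}` — `4, 2, 1` for the tori of types (1), (2), (3); the character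
side (`(∀ κ ∈ ⊤, κ a = 1) ↔ a = 0`, the non-trivial characters as coordinate signs) is ★ `SumZeroHyperplaneCharacters` ∕ ★ `PreStabilisationCountSigns`
(`forall_mem_top_addChar_apply_eq_one_iff`) at `K := cartanObsSubgroup ι`, `hK := mem_cartanObsSubgroup_iff`. [cite: Rogawski1990, §5.4 p. 74; §3.6 p. 31] -/
theorem natCard_cartanObsSubgroup : Nat.card ↥(cartanObsSubgroup ι) = 2 ^ (Fintype.card ι - 1) :=
  natCard_addSubgroup_eq_two_pow (cartanObsSubgroup ι) mem_cartanObsSubgroup_iff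

end Obstruction

end Literature.NumberTheory.Rogawski1990

end
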